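import Summits.RiemannHypothesis.RiemannHypothesis.Theses.WeilParity
import Summits.RiemannHypothesis.RiemannHypothesis.Theorems.WeilParityOffLineParityDetectionStubRealEvenSuffices
import Summits.RiemannHypothesis.RiemannHypothesis.Theorems.WeilParityOffLineParityDetectionStubEvenOffLineLowerBound
import Summits.RiemannHypothesis.RiemannHypothesis.Theorems.WeilParityOffLineParityDetectionStubEvenOffLineCauchySchwarz
import Summits.RiemannHypothesis.RiemannHypothesis.Theorems.WeilParityOffLineParityDetectionStubOddOnLineUpperBound
import Summits.RiemannHypothesis.RiemannHypothesis.Theorems.WeilParityOffLineParityDetectionStubDominantQuadrupleOddTrial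
import Summits.RiemannHypothesis.RiemannHypothesis.Theorems.WeilParityOffLineParityDetectionStubBohrTransfer
import Summits.RiemannHypothesis.RiemannHypothesis.Theorems.WeilParityOffLineParityDetectionStubFiniteDefectLocalisation
import Summits.RiemannHypothesis.RiemannHypothesis.Theorems.WeilParityOffLineParityDetectionStubTorusTopHeavySeparated
import Summits.RiemannHypothesis.RiemannHypothesis.Theorems.WeilParityOffLineParityDetectionStubTorusTopHeavyLowOrdinates
import Summits.RiemannHypothesis.RiemannHypothesis.Theorems.WeilParityOffLineParityDetectionStubResidualOneOrdinate
import Summits.RiemannHypothesis.RiemannHypothesis.Theorems.WeilParityOffLineParityDetectionStubResidualCollapse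
import Summits.RiemannHypothesis.RiemannHypothesis.Theorems.WeilParityOffLineParityDetectionStubResidualTwoLight
import Literature.NumberTheory.LFunctions.WeilGroundEnergyParitySplit
import Literature.NumberTheory.LFunctions.WeilZeroSum
import HarnessLib

/-!
# Line `birth` / `registered` — lead skeleton for crux `OffLineParityDetection` (stmt-RiemannHypothesis-15431)

Crux (route `WeilParity`, rank 2, the route's deciding converse): **parity symmetry breaking
detects off-line zeros** — if `ζ(ρ) = 0` with `0 < Re ρ < 1`, `Re ρ ≠ 1/2`, then at some window
`a > 0` some odd `L²`-normalised Weil test `o` on `[-a, a]` beats EVERY even normalised Weil test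
on `[-a, a]` by a fixed margin `m > 0` (the odd sector strictly wins).

## State of the line (reshape r2–r6, 2026-08-17, lead)

Reshape r1 cut the planner's FIN along the zero-side mechanism; wave 1 LANDED all five provable
stubs of r1 (tree `Theorems/WeilParityOffLineParityDetection*.lean`, all sorry-free, axioms
`propext/Classical.choice/Quot.sound`):

* REAL `stub_realEvenSuffices` (p149031) — real-even lower bounds transfer to complex even tests;
* EVEN-LOW `stub_evenOffLineLowerBound` (p149916) — `Σ_{ρ∈S} m(ρ) Re ê(ρ)² ≤ Re Q(e)` for real
  even `e`, `S` = finite off-line set (zero side, on-line terms `|ê|² ≥ 0` dropped);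
* EVEN-CS `stub_evenOffLineCauchySchwarz` (p147639) — the explicit threshold
  `x(a) = -Σ_S m ∫_{-a}^{a} sinh²(ηt) sin²(γt) dt ≤ Σ_S m Re ê(ρ)²` on normalised real even `e`;
* ODD-ON `stub_oddOnLineUpperBound` (p147622) — `Re Q(o) ≤ (‖o‖₁+‖o″‖₁)² Σ m/(1+γ²)² - Σ_S m Re ô(ρ)²`
  for real odd `o` (on the line `|ô(1/2+iγ)| ≤ (‖o‖₁+‖o″‖₁)/(1+γ²)`);
* TRIAL `stub_dominantQuadrupleOddTrial` (p151331, with helpers TrialIntegrals p149727,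
  TrialCutoff p150216, TrialTransforms p150476, TrialDominant p150981; ζ-free real analysis) — a
  strictly dominant quadruple `{ρ₀, ρ̄₀, 1-ρ₀, 1-ρ̄₀}` is undercut by the odd trial
  `χ(t) sinh(η₀t) cos(γ₀t)` at the phases `2γ₀a + arctan(η₀/γ₀) ≡ π/2`, margin `≍ e^{4η₀a}/|ρ₀-1/2|`.

Hence the DOMINANT finite-defect case is CLOSED in this file (`dominantFiniteDefectDetection`,
no stub hypotheses).  What remains open, and is registered as stubs from r2 on:

* **RESONANT** (finite off-line set, ≥ 2 distinct quadruples at the maximal offset).  Wave 1's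
  research worker (RESONANT-analysis.md on the item) and the strategists (STRATEGY-CENSUS.md,
  line `mirror_torus`) independently reduced it to ONE ζ-free finite-dimensional inequality: to
  leading order `e^{2η₀a}` the two sectors are EXACTLY tied (Takagi / quarter-turn antisymmetry of
  the endpoint form), and odd strictly wins at leading order iff the endpoint torus form
  `M(θ(a)) = Σ_T m (|C⟩⟨C| - |S⟩⟨S|)` is TOP-HEAVY, `λ_max + λ_min > 0`, at the phase point
  `θ(a) = a·(Im ρ)_{ρ∈T}` — proved on paper for `|T| = 1` quadruple (TRIAL's phase law) and for
  quarter-turn-invariant orbit closures, numerically without exception (≈ 2 500 + 2 100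
  configurations, two independent codes), OPEN for odd-sum ordinate lattices.  The lead ADOPTS the
  strategist's typed split of RESONANT (their bridge `resonantFiniteDefectDetection_of`, line
  `mirror_torus`; TORUS verbatim, BOHR/LOC reshaped in r3 to carry the FIXED gaining profile `f₀`
  through — the strategist's shape hid it behind `∃ f` inside `∃ᶠ a`, losing the uniformity LOC
  needs): **TORUS** `stub_torusTopHeavy` (ζ-free, the open core of the finite case) ⇒ **BOHR**
  `stub_bohrTransfer` (RH-free recurrence by simultaneous Dirichlet approximation; M) ⇒ **LOC**
  `stub_finiteDefectLocalisation` (RH-free real analysis with the mirror-odd witness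
  `f₀(a-t) - f₀(a+t)` whose energy is an EXACT generalised Dirichlet series; L).
  Wave 2 LANDED BOHR (p152991) and LOC (p156474 + six Loc* helpers), and its TORUS research worker
  (TORUS-analysis.md on the item) proved on paper two regimes with explicit constants; r4 registers
  TORUS as **TORUS-SEP** (provable now) ∨ **TORUS-LOW** (provable now) ∨ **TORUS-RESIDUAL** (the
  open core of the finite case: odd-sum lattices with a short scale), `torusTopHeavy_of`.
  Wave 3 LANDED TORUS-SEP (p158952 + six TorusGram* helpers) and TORUS-LOW (p157850 + TorusHalfLine), and its
  RESIDUAL research worker (RESIDUAL-analysis.md + interval certificate on the item) cut the residue; r5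
  registers RESIDUAL as **ONE-ORDINATE** ∨ **COLLAPSE** ∨ **TWO-LIGHT** (all provable now) ∨ **CORE** (open:
  CERT-region port, FAR, HIGH-2, J ≥ 3), `torusTopHeavyResidual_of`.
  Wave 4 LANDED RESIDUAL-ONE (p167844), RESIDUAL-COLLAPSE (p168401 + ResidualCollLipschitz p168196) and
  RESIDUAL-TWO-LIGHT (p168260); r6 leaves exactly TWO open stubs: **RESIDUAL-CORE** and **INF**.
* **INF** `stub_infiniteDefectDetection` (the crux's XL open core, unchanged): with infinitely
  many off-line zeros no finite top layer need exist (supremal offset unattained ⇒ the even floor,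
  bounded via dropped on-line terms, uses the supremum for free while every odd witness pays its
  on-line penalty at a finite height — the "drop A(e)" method provably loses; attained but with an
  infinite tail ⇒ Bessel/large-sieve control of `Σ_off m (Im ê)²` over sparse high clusters is
  needed); see NOTES.md §INF of the lead.

`OffLineParityDetection_of (hSep) (hLow) (hRes) (hInf)` (sorry-free; stub statements BY NAME via
`type_of%` abbrevs): `S` finite or infinite (`Set.finite_or_infinite`); finite & some `ρ₀ ∈ S`
strictly dominant ⇒ `dominantFiniteDefectDetection` (landed stubs only); finite & no dominant `ρ₀`
⇒ TORUS (`torusTopHeavy_of`: SEP ∨ LOW ∨ RESIDUAL) ⇒ BOHR (landed) ⇒ LOC (landed)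
(`finiteDefectDetection_of_torus`, the strategist's glue);
infinite ⇒ INF; then `ε_od(a)` is the infimum of the nonempty odd sphere
(`exists_lt_of_csInf_lt`), REAL (landed) transfers the even bound to complex even tests, margin
`m = x - Re Q(o)`.  Calibration `detection_of_OffLineParityDetection`: the crux implies the
common conclusion of the detection statements, so the cut loses no strength.

Disproof used: none on file (`ledger crux ls`, 2026-08-17: no Disproof.lean; CRUX-ATTACK-r1.md of
the refuter records "survives"; its `CruxAttack.lean` proves the crux ↔ (EvenSectorWins → RH in
the strip), i.e. the crux is exactly the route's converse — consistent with this skeleton).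
-/

set_option linter.dupNamespace false

noncomputable section

namespace Summit.RiemannHypothesis.RiemannHypothesis.Cruxes.OffLineParityDetection.Birth

open MeasureTheory Set Filter
open scoped ComplexConjugate
open Literature.NumberTheory.LFunctions
open Summit.RiemannHypothesis.RiemannHypothesis.Theses.WeilParity (OffLineParityDetection)
open Summit.RiemannHypothesis.RiemannHypothesis.Theorems

/-! ### Landed stubs of reshape r1 (no `sorry`; kept here by name for the record) -/

/-- **REAL** (LANDED, p149031): real-even lower bounds on a window transfer to complex even tests.
[cite: Bombieri2000Weil, §3–§4 (T[f * f̄*] hermitian); Weil1952] -/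
theorem stub_realEvenSuffices :
    ∀ a x : ℝ,
      (∀ e : ℝ → ℂ, IsWeilTest e → tsupport e ⊆ Set.Icc (-a) a → (∀ t, e (-t) = e t) →
        (∀ t, (e t).im = 0) → ∫ t, ‖e t‖ ^ 2 = (1 : ℝ) → x ≤ (weilQuadratic e).re) →
      ∀ e : ℝ → ℂ, IsWeilTest e → tsupport e ⊆ Set.Icc (-a) a → (∀ t, e (-t) = e t) →
        ∫ t, ‖e t‖ ^ 2 = (1 : ℝ) → x ≤ (weilQuadratic e).re :=
  WeilParityOffLineParityDetection.stub_realEvenSuffices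

/-- **EVEN-LOW** (LANDED, p149916): `Σ_{ρ∈S} m(ρ) Re ê(ρ)² ≤ Re Q(e)` for real even `e`.
[cite: Bombieri2000Weil, §3 Thm. 1 (zero-side form); Weil1952] -/
theorem stub_evenOffLineLowerBound :
    ∀ e : ℝ → ℂ, IsWeilTest e → (∀ t, e (-t) = e t) → (∀ t, (e t).im = 0) →
      ∀ hS : ({ρ : ℂ | riemannZeta ρ = 0 ∧ 0 < ρ.re ∧ ρ.re < 1 ∧ ρ.re ≠ 1 / 2}).Finite,
        ∑ ρ ∈ hS.toFinset, (riemannZetaZeroOrder ρ : ℝ) * ((weilMellin e ρ) ^ 2).re ≤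
          (weilQuadratic e).re :=
  WeilParityOffLineParityDetection.stub_evenOffLineLowerBound

/-- **EVEN-CS** (LANDED, p147639): the Cauchy–Schwarz threshold `x(a) ≤ Σ_S m Re ê(ρ)²`.
[folklore] -/
theorem stub_evenOffLineCauchySchwarz :
    ∀ (a : ℝ) (e : ℝ → ℂ), IsWeilTest e → tsupport e ⊆ Set.Icc (-a) a → (∀ t, e (-t) = e t) →
      (∀ t, (e t).im = 0) → ∫ t, ‖e t‖ ^ 2 = (1 : ℝ) →
      ∀ hS : ({ρ : ℂ | riemannZeta ρ = 0 ∧ 0 < ρ.re ∧ ρ.re < 1 ∧ ρ.re ≠ 1 / 2}).Finite,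
        -(∑ ρ ∈ hS.toFinset, (riemannZetaZeroOrder ρ : ℝ) *
            ∫ t in Set.Icc (-a) a, Real.sinh ((ρ.re - 1 / 2) * t) ^ 2 * Real.sin (ρ.im * t) ^ 2) ≤
          ∑ ρ ∈ hS.toFinset, (riemannZetaZeroOrder ρ : ℝ) * ((weilMellin e ρ) ^ 2).re :=
  WeilParityOffLineParityDetection.stub_evenOffLineCauchySchwarz

/-- **ODD-ON** (LANDED, p147622): on-line terms of a real odd test are bounded by
`(‖o‖₁+‖o″‖₁)² Σ m/(1+γ²)²`. [folklore] -/
theorem stub_oddOnLineUpperBound :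
    ∀ o : ℝ → ℂ, IsWeilTest o → (∀ t, o (-t) = -o t) → (∀ t, (o t).im = 0) →
      ∀ hS : ({ρ : ℂ | riemannZeta ρ = 0 ∧ 0 < ρ.re ∧ ρ.re < 1 ∧ ρ.re ≠ 1 / 2}).Finite,
        (weilQuadratic o).re ≤
          ((∫ t, ‖o t‖) + ∫ t, ‖deriv (deriv o) t‖) ^ 2 *
              (∑' ρ : ZetaZeros.riemannZetaNontrivialZeros, weilZeroWeight (ρ : ℂ)) -
            ∑ ρ ∈ hS.toFinset, (riemannZetaZeroOrder ρ : ℝ) * ((weilMellin o ρ) ^ 2).re :=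
  WeilParityOffLineParityDetection.stub_oddOnLineUpperBound

/-- **TRIAL** (LANDED, p151331): the dominant-quadruple odd trial (ζ-free). [folklore] -/
theorem stub_dominantQuadrupleOddTrial :
    ∀ (T : Finset ℂ) (w : ℂ → ℝ) (ρ₀ : ℂ), ρ₀ ∈ T → ρ₀.re ≠ 1 / 2 → 0 < w ρ₀ →
      (∀ ρ ∈ T, 0 ≤ w ρ) →
      (∀ ρ ∈ T, |ρ.re - 1 / 2| < |ρ₀.re - 1 / 2| ∨ ρ = ρ₀ ∨ ρ = conj ρ₀ ∨ ρ = 1 - ρ₀ ∨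
        ρ = 1 - conj ρ₀) →
      ∀ Z : ℝ, ∃ a : ℝ, 0 < a ∧ ∃ o : ℝ → ℂ, IsWeilTest o ∧ tsupport o ⊆ Set.Icc (-a) a ∧
        (∀ t, o (-t) = -o t) ∧ (∀ t, (o t).im = 0) ∧ 0 < ∫ t, ‖o t‖ ^ 2 ∧
        ((∫ t, ‖o t‖) + ∫ t, ‖deriv (deriv o) t‖) ^ 2 * Z -
            ∑ ρ ∈ T, w ρ * ((weilMellin o ρ) ^ 2).re <
          -(∑ ρ ∈ T, w ρ * ∫ t in Set.Icc (-a) a,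
              Real.sinh ((ρ.re - 1 / 2) * t) ^ 2 * Real.sin (ρ.im * t) ^ 2) * ∫ t, ‖o t‖ ^ 2 :=
  WeilParityOffLineParityDetection.stub_dominantQuadrupleOddTrial

/-! ### Registered stubs (open) -/

/-! #### TORUS, cut three ways (reshape r4): SEP ∨ LOW ∨ RESIDUAL

The strategist's ζ-free stub `stub_torusTopHeavy` (registered r2–r3; statement kept below as the
derived theorem `torusTopHeavy_of`) says: for a finite nonempty top layer `T ⊂ {Re = 1/2 + η₀}`
with positive weights `w`, the mirror-pairing form
`gain(a, f) = Σ_T w Re(e^{2i(Im ρ)a} F_f(ρ - 1/2)²)`, `F_f(z) = ∫₀^∞ f e^{-zu}`, is TOP-HEAVY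
(`Φ(a) = λ_max + λ_min > 0`) at some phase point `a`.  Wave 2's research worker (TORUS-analysis.md on
the item) reduced it by an elementary one-sided test-vector lemma (`Φ(a) ≥ λ_max M_c(a) -
λ_max M_s(a) - R_c(a)`, Rayleigh quotients + Cauchy–Schwarz only) and a Perron–Frobenius sign chain
in the quarter window `0 < a ≤ π/(4 max|Im ρ|)` to two PROVED regimes with explicit constants and
one open residue; the lead registers exactly that cut.  (General `T` folds onto absolute ordinates
with class-summed weights, TORUS-analysis §1.2, so no conjugation-symmetry hypothesis is needed.) -/

/-- **(LANDED p158952, + TorusGram* helpers p157486 p157810 p158011 p158161 p158327 p158557)** Stub **TORUS-SEP** (ζ-free; PROVABLE NOW by TORUS-analysis.md §5.2, Theorem SEP; L): if every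
ordinate and every gap between distinct absolute ordinates of the top layer is at least
`8 · card T · √(η₀ · |Im τ|)` for every `τ ∈ T` (i.e. `≥ 8J√(η₀ γ_max)`), the form is top-heavy — at
the explicit phase point `a = π/(4 γ_max)`: there (C1) the sine Gram `M_s` is entrywise `≥ 0`, (C2)
`U = M_c - M_s = [√(m_j m_k) h_a(γ_j+γ_k)] ≥ 0` entrywise with `U_jj ≥ (2a/π)e^{-2η₀a} m_j`
(`h_a(ω) = ∫₀^∞ e^{-2η₀u} cos(ω(u-a)) du = (2η₀ cos ωa + ω sin ωa)/(4η₀²+ω²)`), so a non-negative unit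
maximiser `y` of `M_s` gives `λ_max M_c ≥ λ_max M_s + Σ U_jj y_j²`, while the leakage
`R_c ≤ 15.4 J m_max/(K²η₀)` (`K = min(γ_min, Δ_min)/η₀`; Gershgorin for the cosine Gram) is beaten
as soon as `K²η₀/γ_max > 31.8 J²`, which the hypothesis (`64 J²`) provides; danger bound
`D := λ_max M_s`, gaining profile = a smooth compactly supported `L²`-approximant of
`Σ_j x_j √m_j e^{-η₀u} cos(γ_j(u-a))` (`gain` is `L²`-continuous: `|F_f(z)|² ≤ ‖f‖²/(2η₀)`).
Numerics: 445/445 configurations in the regime, chain/Φ ≥ 0.128. [folklore] -/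
theorem stub_torusTopHeavySeparated :
    ∀ η₀ : ℝ, 0 < η₀ → ∀ T : Finset ℂ, T.Nonempty → (∀ ρ ∈ T, ρ.re = 1 / 2 + η₀) →
      ∀ w : ℂ → ℝ, (∀ ρ ∈ T, 0 < w ρ) →
      (∀ ρ ∈ T, ∀ τ ∈ T, 64 * (T.card : ℝ) ^ 2 * η₀ * |τ.im| ≤ ρ.im ^ 2) →
      (∀ ρ ∈ T, ∀ σ ∈ T, ∀ τ ∈ T, |ρ.im| ≠ |σ.im| →
        64 * (T.card : ℝ) ^ 2 * η₀ * |τ.im| ≤ (|ρ.im| - |σ.im|) ^ 2) →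
      ∃ δ : ℝ, 0 < δ ∧ ∃ a : ℝ, ∃ D : ℝ, 0 ≤ D ∧
        (∀ f : ℝ → ℝ, ContDiff ℝ (⊤ : ℕ∞) f → HasCompactSupport f → tsupport f ⊆ Set.Ici 0 →
          -(∑ ρ ∈ T, w ρ * (Complex.exp (2 * (ρ.im : ℂ) * (a : ℂ) * Complex.I) *
              (∫ u in Set.Ioi (0 : ℝ), (f u : ℂ) * Complex.exp (-((ρ - 1 / 2) * (u : ℂ)))) ^ 2).re)
            ≤ D * ∫ u in Set.Ioi (0 : ℝ), f u ^ 2) ∧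
        (∃ f : ℝ → ℝ, ContDiff ℝ (⊤ : ℕ∞) f ∧ HasCompactSupport f ∧ tsupport f ⊆ Set.Ici 0 ∧
          0 < ∫ u in Set.Ioi (0 : ℝ), f u ^ 2 ∧
          (D + δ) * ∫ u in Set.Ioi (0 : ℝ), f u ^ 2 ≤
            ∑ ρ ∈ T, w ρ * (Complex.exp (2 * (ρ.im : ℂ) * (a : ℂ) * Complex.I) *
              (∫ u in Set.Ioi (0 : ℝ), (f u : ℂ) * Complex.exp (-((ρ - 1 / 2) * (u : ℂ)))) ^ 2).re) :=
  WeilParityOffLineParityDetection.stub_torusTopHeavySeparated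

/-- **(LANDED p157850, + TorusHalfLine p157621)** Stub **TORUS-LOW** (ζ-free; PROVABLE NOW by TORUS-analysis.md §5.3, Theorem LOW; M): if every
ordinate of the top layer is at most the offset, `|Im ρ| ≤ η₀`, the form is top-heavy at the phase
point `a = 0`: the rank-one test vector `e₀(u) = e^{-η₀u}` gives
`λ_max ≥ ⟨e₀, T₀ e₀⟩/‖e₀‖² = 2η₀ Σ_j m_j (4η₀² - γ_j²)/(4η₀² + γ_j²)²`, the trace bound on the sine
part gives `-λ_min ≤ Σ_j m_j ‖s_j‖² = Σ_j m_j γ_j²/(4η₀(η₀² + γ_j²))`, and each bracket of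
`Φ(0) ≥ Σ_j (m_j/η₀)[2(4 - x_j²)/(4 + x_j²)² - x_j²/(4(1 + x_j²))]`, `x_j = γ_j/η₀ ≤ 1`, is
`≥ 6/25 - 1/8 > 0`; `D := Σ m ‖s‖²`, gaining profile = a smooth compactly supported cut-off of `e₀`.
Numerics: 1 406/1 406. [folklore] -/
theorem stub_torusTopHeavyLowOrdinates :
    ∀ η₀ : ℝ, 0 < η₀ → ∀ T : Finset ℂ, T.Nonempty → (∀ ρ ∈ T, ρ.re = 1 / 2 + η₀) →
      ∀ w : ℂ → ℝ, (∀ ρ ∈ T, 0 < w ρ) →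
      (∀ ρ ∈ T, |ρ.im| ≤ η₀) →
      ∃ δ : ℝ, 0 < δ ∧ ∃ a : ℝ, ∃ D : ℝ, 0 ≤ D ∧
        (∀ f : ℝ → ℝ, ContDiff ℝ (⊤ : ℕ∞) f → HasCompactSupport f → tsupport f ⊆ Set.Ici 0 →
          -(∑ ρ ∈ T, w ρ * (Complex.exp (2 * (ρ.im : ℂ) * (a : ℂ) * Complex.I) *
              (∫ u in Set.Ioi (0 : ℝ), (f u : ℂ) * Complex.exp (-((ρ - 1 / 2) * (u : ℂ)))) ^ 2).re)
            ≤ D * ∫ u in Set.Ioi (0 : ℝ), f u ^ 2) ∧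
        (∃ f : ℝ → ℝ, ContDiff ℝ (⊤ : ℕ∞) f ∧ HasCompactSupport f ∧ tsupport f ⊆ Set.Ici 0 ∧
          0 < ∫ u in Set.Ioi (0 : ℝ), f u ^ 2 ∧
          (D + δ) * ∫ u in Set.Ioi (0 : ℝ), f u ^ 2 ≤
            ∑ ρ ∈ T, w ρ * (Complex.exp (2 * (ρ.im : ℂ) * (a : ℂ) * Complex.I) *
              (∫ u in Set.Ioi (0 : ℝ), (f u : ℂ) * Complex.exp (-((ρ - 1 / 2) * (u : ℂ)))) ^ 2).re) :=
  WeilParityOffLineParityDetection.stub_torusTopHeavyLowOrdinates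

/-! #### TORUS-RESIDUAL, cut further (reshape r5): ONE-ORDINATE ∨ COLLAPSE ∨ TWO-LIGHT ∨ CORE

Wave 3's research worker (RESIDUAL-analysis.md on the item) treated `J = 2` completely: four exact elementary
tools (BLOCK lemma, LIGHT, LOW-DROP, COLLAPSE), a first-order COLLECTIVE `J = 1` law, and a rigorous
interval-arithmetic CERTIFICATE (independently re-verified, 224 784 records, 0 failures) for every two-ordinate
top layer with `γ_max ≤ 100 η₀`; the lead registers the three pieces the worker rates PROVABLE NOW and keeps
the rest (CERT region, FAR, HIGH-2, `J ≥ 3`) as the single open CORE stub.  All statements below are in the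
TORUS data `(η₀, T, w)`; by §1.2 of TORUS-analysis only absolute ordinates `|Im ρ|` and class weights matter. -/

/-- **(LANDED p167844)** Stub **RESIDUAL-ONE** (ζ-free; PROVABLE NOW, RESIDUAL-analysis §0/§6 R1; M): a top layer with a single
absolute ordinate `g` is top-heavy — the `J = 1` law `Φ(a) = (M/2|z|) cos(2ga − arg z)` of the class-summed
weight `M` (`z = η₀ + ig`; for `g = 0` the form is a PSD rank-one form and `a = 0` works); this is the half-line
form of the landed TRIAL's phase law: danger `D := λ_max` of the sine Gram (rank one), gaining profile = cut-off of
`e^{-η₀u} cos(g(u − a))` at `2ga ≡ arg z`. [folklore] -/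
theorem stub_residualOneOrdinate :
    ∀ η₀ : ℝ, 0 < η₀ → ∀ T : Finset ℂ, T.Nonempty → (∀ ρ ∈ T, ρ.re = 1 / 2 + η₀) →
      ∀ w : ℂ → ℝ, (∀ ρ ∈ T, 0 < w ρ) →
      (T.image (fun ρ : ℂ ↦ |ρ.im|)).card = 1 →
      ∃ δ : ℝ, 0 < δ ∧ ∃ a : ℝ, ∃ D : ℝ, 0 ≤ D ∧
        (∀ f : ℝ → ℝ, ContDiff ℝ (⊤ : ℕ∞) f → HasCompactSupport f → tsupport f ⊆ Set.Ici 0 →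
          -(∑ ρ ∈ T, w ρ * (Complex.exp (2 * (ρ.im : ℂ) * (a : ℂ) * Complex.I) *
              (∫ u in Set.Ioi (0 : ℝ), (f u : ℂ) * Complex.exp (-((ρ - 1 / 2) * (u : ℂ)))) ^ 2).re)
            ≤ D * ∫ u in Set.Ioi (0 : ℝ), f u ^ 2) ∧
        (∃ f : ℝ → ℝ, ContDiff ℝ (⊤ : ℕ∞) f ∧ HasCompactSupport f ∧ tsupport f ⊆ Set.Ici 0 ∧
          0 < ∫ u in Set.Ioi (0 : ℝ), f u ^ 2 ∧
          (D + δ) * ∫ u in Set.Ioi (0 : ℝ), f u ^ 2 ≤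
            ∑ ρ ∈ T, w ρ * (Complex.exp (2 * (ρ.im : ℂ) * (a : ℂ) * Complex.I) *
              (∫ u in Set.Ioi (0 : ℝ), (f u : ℂ) * Complex.exp (-((ρ - 1 / 2) * (u : ℂ)))) ^ 2).re) :=
  WeilParityOffLineParityDetection.stub_residualOneOrdinate

/-- **(LANDED p168401, + ResidualCollLipschitz p168196)** Stub **RESIDUAL-COLLAPSE** (ζ-free; PROVABLE NOW, RESIDUAL-analysis §2.2 / §6 R2; M–L): a top layer whose
ordinates form ONE tight cluster around some `gbar ≥ 0` in the weighted sense
`2√2 · √(η₀² + gbar²) · Σ_T w |(|Im ρ| − gbar)| < η₀² Σ_T w` is top-heavy.  Mechanism: the form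
`f ↦ gain(a, f)` is `√2 w_ρ ν(a)`-Lipschitz in each ordinate in OPERATOR norm (`ν(a)² = ∫₀^∞ (u−a)² e^{-2η₀u}`,
`|∂_g ⟨f, e^{-η₀u} e^{-ig(u−a)}⟩| ≤ ν(a)‖f‖`), so `Φ(T) ≥ Φ(T_coll) − 2√2 ν(a) Σ w |g − gbar|` (Weyl for sup and
inf of a quadratic form), and the collapsed one-class form obeys the `J = 1` law with weight `Σ w` at
`a = arctan(gbar/η₀)/(2 gbar)` (`ν ≤ 1/2` there, in `η₀ = 1` units). [folklore] -/
theorem stub_residualCollapse :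
    ∀ η₀ : ℝ, 0 < η₀ → ∀ T : Finset ℂ, T.Nonempty → (∀ ρ ∈ T, ρ.re = 1 / 2 + η₀) →
      ∀ w : ℂ → ℝ, (∀ ρ ∈ T, 0 < w ρ) →
      (∃ gbar : ℝ, 0 ≤ gbar ∧
        2 * Real.sqrt 2 * Real.sqrt (η₀ ^ 2 + gbar ^ 2) * (∑ ρ ∈ T, w ρ * |(|ρ.im| - gbar)|) <
          η₀ ^ 2 * ∑ ρ ∈ T, w ρ) →
      ∃ δ : ℝ, 0 < δ ∧ ∃ a : ℝ, ∃ D : ℝ, 0 ≤ D ∧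
        (∀ f : ℝ → ℝ, ContDiff ℝ (⊤ : ℕ∞) f → HasCompactSupport f → tsupport f ⊆ Set.Ici 0 →
          -(∑ ρ ∈ T, w ρ * (Complex.exp (2 * (ρ.im : ℂ) * (a : ℂ) * Complex.I) *
              (∫ u in Set.Ioi (0 : ℝ), (f u : ℂ) * Complex.exp (-((ρ - 1 / 2) * (u : ℂ)))) ^ 2).re)
            ≤ D * ∫ u in Set.Ioi (0 : ℝ), f u ^ 2) ∧
        (∃ f : ℝ → ℝ, ContDiff ℝ (⊤ : ℕ∞) f ∧ HasCompactSupport f ∧ tsupport f ⊆ Set.Ici 0 ∧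
          0 < ∫ u in Set.Ioi (0 : ℝ), f u ^ 2 ∧
          (D + δ) * ∫ u in Set.Ioi (0 : ℝ), f u ^ 2 ≤
            ∑ ρ ∈ T, w ρ * (Complex.exp (2 * (ρ.im : ℂ) * (a : ℂ) * Complex.I) *
              (∫ u in Set.Ioi (0 : ℝ), (f u : ℂ) * Complex.exp (-((ρ - 1 / 2) * (u : ℂ)))) ^ 2).re) :=
  WeilParityOffLineParityDetection.stub_residualCollapse

/-- **(LANDED p168260)** Stub **RESIDUAL-TWO-LIGHT** (ζ-free; PROVABLE NOW, RESIDUAL-analysis §2.1 / §6 R3; M): a top layer with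
exactly two absolute ordinates `0 ≤ g₁ < g₂` one of whose classes is LIGHT — class weights `M₁, M₂` with
`M₂ √(η₀²+g₁²)(1 + η₀/√(η₀²+g₂²)) < M₁ η₀` or the symmetric inequality — is top-heavy: by the BLOCK lemma
(`Φ(a) ≥ Φ_j(a) − 2β_k(a)`, Rayleigh quotients of each ordinate's own rank-2 eigen-splitting
`B_j = α_j p_j p_jᵀ − β_j n_j n_jᵀ`, `α_j − β_j = Φ_j = (M_j/2|z_j|) cos(2g_j a − arg z_j)`,
`β_k ≤ (M_k/4)(1 + η₀/|z_k|)` in `η₀ = 1` units) at the heavy class's optimal phase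
`a_j = arctan(g_j/η₀)/(2 g_j)`. [folklore] -/
theorem stub_residualTwoLight :
    ∀ η₀ : ℝ, 0 < η₀ → ∀ T : Finset ℂ, T.Nonempty → (∀ ρ ∈ T, ρ.re = 1 / 2 + η₀) →
      ∀ w : ℂ → ℝ, (∀ ρ ∈ T, 0 < w ρ) →
      ∀ g₁ g₂ : ℝ, 0 ≤ g₁ → g₁ < g₂ → (∀ ρ ∈ T, |ρ.im| = g₁ ∨ |ρ.im| = g₂) →
      ((∑ ρ ∈ T.filter (fun ρ : ℂ ↦ |ρ.im| = g₂), w ρ) * Real.sqrt (η₀ ^ 2 + g₁ ^ 2) *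
            (1 + η₀ / Real.sqrt (η₀ ^ 2 + g₂ ^ 2)) <
          (∑ ρ ∈ T.filter (fun ρ : ℂ ↦ |ρ.im| = g₁), w ρ) * η₀ ∨
        (∑ ρ ∈ T.filter (fun ρ : ℂ ↦ |ρ.im| = g₁), w ρ) * Real.sqrt (η₀ ^ 2 + g₂ ^ 2) *
            (1 + η₀ / Real.sqrt (η₀ ^ 2 + g₁ ^ 2)) <
          (∑ ρ ∈ T.filter (fun ρ : ℂ ↦ |ρ.im| = g₂), w ρ) * η₀) →
      ∃ δ : ℝ, 0 < δ ∧ ∃ a : ℝ, ∃ D : ℝ, 0 ≤ D ∧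
        (∀ f : ℝ → ℝ, ContDiff ℝ (⊤ : ℕ∞) f → HasCompactSupport f → tsupport f ⊆ Set.Ici 0 →
          -(∑ ρ ∈ T, w ρ * (Complex.exp (2 * (ρ.im : ℂ) * (a : ℂ) * Complex.I) *
              (∫ u in Set.Ioi (0 : ℝ), (f u : ℂ) * Complex.exp (-((ρ - 1 / 2) * (u : ℂ)))) ^ 2).re)
            ≤ D * ∫ u in Set.Ioi (0 : ℝ), f u ^ 2) ∧
        (∃ f : ℝ → ℝ, ContDiff ℝ (⊤ : ℕ∞) f ∧ HasCompactSupport f ∧ tsupport f ⊆ Set.Ici 0 ∧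
          0 < ∫ u in Set.Ioi (0 : ℝ), f u ^ 2 ∧
          (D + δ) * ∫ u in Set.Ioi (0 : ℝ), f u ^ 2 ≤
            ∑ ρ ∈ T, w ρ * (Complex.exp (2 * (ρ.im : ℂ) * (a : ℂ) * Complex.I) *
              (∫ u in Set.Ioi (0 : ℝ), (f u : ℂ) * Complex.exp (-((ρ - 1 / 2) * (u : ℂ)))) ^ 2).re) :=
  WeilParityOffLineParityDetection.stub_residualTwoLight

/-- Stub **RESIDUAL-CORE** (ζ-free; the OPEN core of the finite-defect case after r5): top layers that are
neither separated nor low (r4), have ≥ 2 absolute ordinates, are not one tight cluster, and — if they have exactly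
two absolute ordinates — have no light class.  Contents (RESIDUAL-analysis §6–§7): (R4) two ordinates with
`γ_max ≤ 100 η₀` — CERTIFIED by a rigorous interval box cover (work/stubs/residual/cert_X30.jsonl, cert_X100.jsonl;
independent checker "CERTIFICATE ACCEPTED"; kit j026575 re-check), Lean port = computational; (R5) two ordinates
FAR apart (`25(η₀² + g₁²) ≤ η₀ g₂`) — provable modulo the κ-lemma `‖P_{W₁}P_{W₂}‖ ≤ 5η₀/g₂` (hand version:
constant 9, threshold 250); (R6) HIGH-2 — `g₂ > 100η₀`, `η₀ g₂ < 25(η₀²+g₁²)`, weights inside the light window: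
known to FIRST order only (collective `J = 1` law `Φ(θ) = 2λ₀ Re∫w₀²/∫|w₀|² + O(m/γ²)`, numerically uniform,
`inf ĉ = 1/4`) — OPEN; (R7) `J ≥ 3` not collapsible — OPEN (tools: COLLAPSE, LOW-DROP, collective law; clusters
of diameter up to `3η₀` behave like classes numerically).  No counterexample in any regime across three waves
(≈ 20 000 configurations, three independent codes, one certificate). [folklore] -/
theorem stub_residualCore :
    ∀ η₀ : ℝ, 0 < η₀ → ∀ T : Finset ℂ, T.Nonempty → (∀ ρ ∈ T, ρ.re = 1 / 2 + η₀) →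
      ∀ w : ℂ → ℝ, (∀ ρ ∈ T, 0 < w ρ) →
      ¬ ((∀ ρ ∈ T, ∀ τ ∈ T, 64 * (T.card : ℝ) ^ 2 * η₀ * |τ.im| ≤ ρ.im ^ 2) ∧
          (∀ ρ ∈ T, ∀ σ ∈ T, ∀ τ ∈ T, |ρ.im| ≠ |σ.im| →
            64 * (T.card : ℝ) ^ 2 * η₀ * |τ.im| ≤ (|ρ.im| - |σ.im|) ^ 2)) →
      ¬ (∀ ρ ∈ T, |ρ.im| ≤ η₀) →
      ¬ ((T.image (fun ρ : ℂ ↦ |ρ.im|)).card = 1) →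
      ¬ (∃ gbar : ℝ, 0 ≤ gbar ∧
        2 * Real.sqrt 2 * Real.sqrt (η₀ ^ 2 + gbar ^ 2) * (∑ ρ ∈ T, w ρ * |(|ρ.im| - gbar)|) <
          η₀ ^ 2 * ∑ ρ ∈ T, w ρ) →
      ¬ (∃ g₁ g₂ : ℝ, 0 ≤ g₁ ∧ g₁ < g₂ ∧ (∀ ρ ∈ T, |ρ.im| = g₁ ∨ |ρ.im| = g₂) ∧
        ((∑ ρ ∈ T.filter (fun ρ : ℂ ↦ |ρ.im| = g₂), w ρ) * Real.sqrt (η₀ ^ 2 + g₁ ^ 2) *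
              (1 + η₀ / Real.sqrt (η₀ ^ 2 + g₂ ^ 2)) <
            (∑ ρ ∈ T.filter (fun ρ : ℂ ↦ |ρ.im| = g₁), w ρ) * η₀ ∨
          (∑ ρ ∈ T.filter (fun ρ : ℂ ↦ |ρ.im| = g₁), w ρ) * Real.sqrt (η₀ ^ 2 + g₂ ^ 2) *
              (1 + η₀ / Real.sqrt (η₀ ^ 2 + g₁ ^ 2)) <
            (∑ ρ ∈ T.filter (fun ρ : ℂ ↦ |ρ.im| = g₂), w ρ) * η₀)) →
      ∃ δ : ℝ, 0 < δ ∧ ∃ a : ℝ, ∃ D : ℝ, 0 ≤ D ∧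
        (∀ f : ℝ → ℝ, ContDiff ℝ (⊤ : ℕ∞) f → HasCompactSupport f → tsupport f ⊆ Set.Ici 0 →
          -(∑ ρ ∈ T, w ρ * (Complex.exp (2 * (ρ.im : ℂ) * (a : ℂ) * Complex.I) *
              (∫ u in Set.Ioi (0 : ℝ), (f u : ℂ) * Complex.exp (-((ρ - 1 / 2) * (u : ℂ)))) ^ 2).re)
            ≤ D * ∫ u in Set.Ioi (0 : ℝ), f u ^ 2) ∧
        (∃ f : ℝ → ℝ, ContDiff ℝ (⊤ : ℕ∞) f ∧ HasCompactSupport f ∧ tsupport f ⊆ Set.Ici 0 ∧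
          0 < ∫ u in Set.Ioi (0 : ℝ), f u ^ 2 ∧
          (D + δ) * ∫ u in Set.Ioi (0 : ℝ), f u ^ 2 ≤
            ∑ ρ ∈ T, w ρ * (Complex.exp (2 * (ρ.im : ℂ) * (a : ℂ) * Complex.I) *
              (∫ u in Set.Ioi (0 : ℝ), (f u : ℂ) * Complex.exp (-((ρ - 1 / 2) * (u : ℂ)))) ^ 2).re) := by
  sorry

/-- **TORUS-RESIDUAL from ONE (landed) ∨ COLLAPSE (landed) ∨ TWO-LIGHT (landed) ∨ CORE** (case split; the statement is the
r4-registered `stub_torusTopHeavyResidual` verbatim). [folklore] -/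
theorem torusTopHeavyResidual_of (hCore : type_of% @stub_residualCore) :
    ∀ η₀ : ℝ, 0 < η₀ → ∀ T : Finset ℂ, T.Nonempty → (∀ ρ ∈ T, ρ.re = 1 / 2 + η₀) →
      ∀ w : ℂ → ℝ, (∀ ρ ∈ T, 0 < w ρ) →
      ¬ ((∀ ρ ∈ T, ∀ τ ∈ T, 64 * (T.card : ℝ) ^ 2 * η₀ * |τ.im| ≤ ρ.im ^ 2) ∧
          (∀ ρ ∈ T, ∀ σ ∈ T, ∀ τ ∈ T, |ρ.im| ≠ |σ.im| →
            64 * (T.card : ℝ) ^ 2 * η₀ * |τ.im| ≤ (|ρ.im| - |σ.im|) ^ 2)) →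
      ¬ (∀ ρ ∈ T, |ρ.im| ≤ η₀) →
      ∃ δ : ℝ, 0 < δ ∧ ∃ a : ℝ, ∃ D : ℝ, 0 ≤ D ∧
        (∀ f : ℝ → ℝ, ContDiff ℝ (⊤ : ℕ∞) f → HasCompactSupport f → tsupport f ⊆ Set.Ici 0 →
          -(∑ ρ ∈ T, w ρ * (Complex.exp (2 * (ρ.im : ℂ) * (a : ℂ) * Complex.I) *
              (∫ u in Set.Ioi (0 : ℝ), (f u : ℂ) * Complex.exp (-((ρ - 1 / 2) * (u : ℂ)))) ^ 2).re)
            ≤ D * ∫ u in Set.Ioi (0 : ℝ), f u ^ 2) ∧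
        (∃ f : ℝ → ℝ, ContDiff ℝ (⊤ : ℕ∞) f ∧ HasCompactSupport f ∧ tsupport f ⊆ Set.Ici 0 ∧
          0 < ∫ u in Set.Ioi (0 : ℝ), f u ^ 2 ∧
          (D + δ) * ∫ u in Set.Ioi (0 : ℝ), f u ^ 2 ≤
            ∑ ρ ∈ T, w ρ * (Complex.exp (2 * (ρ.im : ℂ) * (a : ℂ) * Complex.I) *
              (∫ u in Set.Ioi (0 : ℝ), (f u : ℂ) * Complex.exp (-((ρ - 1 / 2) * (u : ℂ)))) ^ 2).re) := by
  intro η₀ hη₀ T hT hTre w hw hnsep hnlow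
  by_cases h1 : (T.image (fun ρ : ℂ ↦ |ρ.im|)).card = 1
  · exact stub_residualOneOrdinate η₀ hη₀ T hT hTre w hw h1
  · by_cases h2 : ∃ gbar : ℝ, 0 ≤ gbar ∧
        2 * Real.sqrt 2 * Real.sqrt (η₀ ^ 2 + gbar ^ 2) * (∑ ρ ∈ T, w ρ * |(|ρ.im| - gbar)|) <
          η₀ ^ 2 * ∑ ρ ∈ T, w ρ
    · exact stub_residualCollapse η₀ hη₀ T hT hTre w hw h2
    · by_cases h3 : ∃ g₁ g₂ : ℝ, 0 ≤ g₁ ∧ g₁ < g₂ ∧ (∀ ρ ∈ T, |ρ.im| = g₁ ∨ |ρ.im| = g₂) ∧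
        ((∑ ρ ∈ T.filter (fun ρ : ℂ ↦ |ρ.im| = g₂), w ρ) * Real.sqrt (η₀ ^ 2 + g₁ ^ 2) *
              (1 + η₀ / Real.sqrt (η₀ ^ 2 + g₂ ^ 2)) <
            (∑ ρ ∈ T.filter (fun ρ : ℂ ↦ |ρ.im| = g₁), w ρ) * η₀ ∨
          (∑ ρ ∈ T.filter (fun ρ : ℂ ↦ |ρ.im| = g₁), w ρ) * Real.sqrt (η₀ ^ 2 + g₂ ^ 2) *
              (1 + η₀ / Real.sqrt (η₀ ^ 2 + g₁ ^ 2)) <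
            (∑ ρ ∈ T.filter (fun ρ : ℂ ↦ |ρ.im| = g₂), w ρ) * η₀)
      · obtain ⟨g₁, g₂, hg₁, hg₁₂, hcls, hlight⟩ := h3
        exact stub_residualTwoLight η₀ hη₀ T hT hTre w hw g₁ g₂ hg₁ hg₁₂ hcls hlight
      · exact hCore η₀ hη₀ T hT hTre w hw hnsep hnlow h1 h2 h3


/-- **TORUS from SEP (landed) ∨ LOW (landed) ∨ RESIDUAL (four stubs)** (sorry-free case split; the statement
is the strategist's `stub_torusTopHeavy` verbatim, registered as this line's TORUS stub in r2–r3). [folklore] -/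
theorem torusTopHeavy_of (hCore : type_of% @stub_residualCore) :
    ∀ η₀ : ℝ, 0 < η₀ → ∀ T : Finset ℂ, T.Nonempty → (∀ ρ ∈ T, ρ.re = 1 / 2 + η₀) →
      ∀ w : ℂ → ℝ, (∀ ρ ∈ T, 0 < w ρ) →
      ∃ δ : ℝ, 0 < δ ∧ ∃ a : ℝ, ∃ D : ℝ, 0 ≤ D ∧
        (∀ f : ℝ → ℝ, ContDiff ℝ (⊤ : ℕ∞) f → HasCompactSupport f → tsupport f ⊆ Set.Ici 0 →
          -(∑ ρ ∈ T, w ρ * (Complex.exp (2 * (ρ.im : ℂ) * (a : ℂ) * Complex.I) *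
              (∫ u in Set.Ioi (0 : ℝ), (f u : ℂ) * Complex.exp (-((ρ - 1 / 2) * (u : ℂ)))) ^ 2).re)
            ≤ D * ∫ u in Set.Ioi (0 : ℝ), f u ^ 2) ∧
        (∃ f : ℝ → ℝ, ContDiff ℝ (⊤ : ℕ∞) f ∧ HasCompactSupport f ∧ tsupport f ⊆ Set.Ici 0 ∧
          0 < ∫ u in Set.Ioi (0 : ℝ), f u ^ 2 ∧
          (D + δ) * ∫ u in Set.Ioi (0 : ℝ), f u ^ 2 ≤
            ∑ ρ ∈ T, w ρ * (Complex.exp (2 * (ρ.im : ℂ) * (a : ℂ) * Complex.I) *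
              (∫ u in Set.Ioi (0 : ℝ), (f u : ℂ) * Complex.exp (-((ρ - 1 / 2) * (u : ℂ)))) ^ 2).re) := by
  intro η₀ hη₀ T hT hTre w hw
  by_cases hsep : (∀ ρ ∈ T, ∀ τ ∈ T, 64 * (T.card : ℝ) ^ 2 * η₀ * |τ.im| ≤ ρ.im ^ 2) ∧
      (∀ ρ ∈ T, ∀ σ ∈ T, ∀ τ ∈ T, |ρ.im| ≠ |σ.im| →
        64 * (T.card : ℝ) ^ 2 * η₀ * |τ.im| ≤ (|ρ.im| - |σ.im|) ^ 2)
  · exact stub_torusTopHeavySeparated η₀ hη₀ T hT hTre w hw hsep.1 hsep.2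
  · by_cases hlow : ∀ ρ ∈ T, |ρ.im| ≤ η₀
    · exact stub_torusTopHeavyLowOrdinates η₀ hη₀ T hT hTre w hw hlow
    · exact torusTopHeavyResidual_of hCore η₀ hη₀ T hT hTre w hw hsep hlow


/-- **(LANDED p152991)** Stub **BOHR** (RH-free; M; the strategist's `mirror_torus` statement RESHAPED by the lead so
that the gaining profile is a FIXED witness `f₀` — the strategist's version hid `f₀` behind an `∃`
inside `∃ᶠ a`, which loses the uniformity LOC needs): if at the phase point `a₀` every profile's
danger is `≤ D` and the profile `f₀` gains `≥ D + δ`, then frequently along `a → ∞` every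
profile's danger is `≤ D'` and THE SAME `f₀` gains `≥ D' + δ/2`, for some `D' ≥ 0`.  Mechanism:
the forms depend on `a` only through the finitely many phases `e^{2i(Im ρ)a}`, `ρ ∈ T`; by
simultaneous Dirichlet approximation (or compactness of the torus `(ℝ/2πℤ)^T`: differences
`τ = n_l - n_k` of a convergent subsequence of `n ↦ (2n·Im ρ mod 2π)_ρ`) the set of `τ` with
`‖e^{2i(Im ρ)τ} - 1‖ ≤ ε` for all `ρ ∈ T` is unbounded above, and along `a = a₀ + τ` every
profile's gain moves by at most `ε Σ_ρ w(ρ) ‖F_f(ρ - 1/2)‖² ≤ ε (Σ w)/(2η₀) · ‖f‖²`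
(Cauchy–Schwarz against `e^{-η₀u}`: `‖∫₀^∞ f e^{-zu}‖² ≤ ‖f‖² ∫₀^∞ e^{-2η₀u}`); take
`ε (Σ w)/(2η₀) ≤ δ/4` and `D' = D + δ/4`. [folklore] -/
theorem stub_bohrTransfer :
    ∀ η₀ : ℝ, 0 < η₀ → ∀ T : Finset ℂ, (∀ ρ ∈ T, ρ.re = 1 / 2 + η₀) →
      ∀ w : ℂ → ℝ, (∀ ρ ∈ T, 0 ≤ w ρ) → ∀ a₀ δ D : ℝ, 0 < δ → 0 ≤ D →
      (∀ f : ℝ → ℝ, ContDiff ℝ (⊤ : ℕ∞) f → HasCompactSupport f → tsupport f ⊆ Set.Ici 0 →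
        -(∑ ρ ∈ T, w ρ * (Complex.exp (2 * (ρ.im : ℂ) * (a₀ : ℂ) * Complex.I) *
            (∫ u in Set.Ioi (0 : ℝ), (f u : ℂ) * Complex.exp (-((ρ - 1 / 2) * (u : ℂ)))) ^ 2).re)
          ≤ D * ∫ u in Set.Ioi (0 : ℝ), f u ^ 2) →
      ∀ f₀ : ℝ → ℝ, ContDiff ℝ (⊤ : ℕ∞) f₀ → HasCompactSupport f₀ → tsupport f₀ ⊆ Set.Ici 0 →
      (D + δ) * ∫ u in Set.Ioi (0 : ℝ), f₀ u ^ 2 ≤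
        ∑ ρ ∈ T, w ρ * (Complex.exp (2 * (ρ.im : ℂ) * (a₀ : ℂ) * Complex.I) *
          (∫ u in Set.Ioi (0 : ℝ), (f₀ u : ℂ) * Complex.exp (-((ρ - 1 / 2) * (u : ℂ)))) ^ 2).re →
      ∃ᶠ a : ℝ in Filter.atTop, ∃ D' : ℝ, 0 ≤ D' ∧
        (∀ f : ℝ → ℝ, ContDiff ℝ (⊤ : ℕ∞) f → HasCompactSupport f → tsupport f ⊆ Set.Ici 0 →
          -(∑ ρ ∈ T, w ρ * (Complex.exp (2 * (ρ.im : ℂ) * (a : ℂ) * Complex.I) *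
              (∫ u in Set.Ioi (0 : ℝ), (f u : ℂ) * Complex.exp (-((ρ - 1 / 2) * (u : ℂ)))) ^ 2).re)
            ≤ D' * ∫ u in Set.Ioi (0 : ℝ), f u ^ 2) ∧
        (D' + δ / 2) * ∫ u in Set.Ioi (0 : ℝ), f₀ u ^ 2 ≤
          ∑ ρ ∈ T, w ρ * (Complex.exp (2 * (ρ.im : ℂ) * (a : ℂ) * Complex.I) *
            (∫ u in Set.Ioi (0 : ℝ), (f₀ u : ℂ) * Complex.exp (-((ρ - 1 / 2) * (u : ℂ)))) ^ 2).re :=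
  WeilParityOffLineParityDetection.stub_bohrTransfer

/-- **(LANDED p156474, + Loc* helpers p154320 p155176 p155274 p155314 p155340 p156033)** Stub **LOC** (RH-free real analysis; L; the strategist's `mirror_torus` statement RESHAPED
by the lead to take the FIXED gaining profile `f₀` of TORUS/BOHR): if the set `S` of off-line
zeros of `ζ` in the strip is FINITE, `η₀ > 0` bounds all offsets `|Re ρ - 1/2|` on `S`, the top
layer `T = {ρ : ζ(ρ) = 0, Re ρ = 1/2 + η₀}` is nonempty, and a fixed profile `f₀` (smooth, compact
support in `[0, ∞)`, `∫ f₀² > 0`) gains `≥ D + δ` against an even danger `≤ D` at frequently many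
`a → ∞` (the `D` may depend on `a`, the margin `δ > 0` and `f₀` do not), then at some window
`a > 0` some odd normalised Weil test beats every REAL even normalised Weil test by a fixed margin.
Mechanism (exact identities, finite sums, one smooth cutoff; `z = ρ - 1/2`,
`F(z) = ∫₀^∞ f₀(u) e^{-zu} du`): take a top-heavy `a` larger than the support radius `R` of `f₀` and
than every constant below; ODD witness `o(t) = f₀(a - t) - f₀(a + t)` (smooth, odd, real, supported
in `[a-R, a] ∪ [-a, -a+R] ⊆ [-a, a]`, `∫|o|² = 2∫f₀²` for `a > R`); its transform is
`ô(ρ) = e^{za}F(z) - e^{-za}F(-z)` (`weilMellin_weilTranslate`), so by the zero-side form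
(`WeilConverse.zeroForm = weilQuadratic`, `pairCoeff_of_odd_real`) and the reflection `ρ ↦ 1-ρ` of
the zero multiset (`riemannZetaZeroOrder_one_sub_holds`):
`Re Q(o) = 2 Re Q(f₀(-·)) - 2 Re Σ_ρ m(ρ) e^{2za} F(z)²`, all sums absolutely convergent
(`|F(z)| ≤ C/(1+γ²)` in the strip, `norm_weilMellin_le`; `weilZeroSummable`); in the series the
top layer `Re z = η₀` is EXACTLY `e^{2η₀a} gain(a, f₀) ≥ e^{2η₀a}(D+δ)∫f₀²`, the reflected layer
`Re z = -η₀` is `O(e^{-2η₀a})`, the finitely many lower off-line layers are `O(e^{2η'a})` with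
`η' < η₀` the next offset, the on-line layer is `O(1)`; hence
`Re Q(o)/∫|o|² ≤ -e^{2η₀a}(D+δ) + O(1 + e^{2η'a})`.  EVEN side: for a real even normalised `e` on
`[-a, a]`, `Re Q(e) ≥ Σ_{ρ∈S} m Re ê(ρ)²` (landed EVEN-LOW); with the profile `ẽ(u) = e(a-u)`
(support in `[0, 2a]`, `∫ẽ² = 1`, and `∫_{u<a} ẽ² = 1/2` by evenness) one has `ê(ρ) = e^{za}F_ẽ(z)`
for every `ρ`, the top layer is `e^{2η₀a} gain(a, ẽ)` and the reflected layer equals it (`ê(1-ρ̄) =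
conj ê(ρ)`, `stub_evenTransfer_conj_weilMellin`); cutting `ẽ` off smoothly to `[0, a]` (`ψ = 1` on
`[0, a-1]`, `0` on `[a, ∞)`) changes `F_ẽ(z)` by `O(e^{-η₀a})` (the cut piece lives where
`|e^{-zu}| ≤ e^{-η₀(a-1)}`), and the danger bound for the admissible profile `ẽψ` with
`∫(ẽψ)² ≤ 1/2` gives `gain(a, ẽ) ≥ -D/2 - O(e^{-η₀a})`; lower layers `≥ -Σ m‖sinh(η'·)sin(γ·)‖² =
-O(a e^{2η'a})` (landed `neg_integral_sinh_sq_mul_sin_sq_le`).  So `Re Q(e) ≥ -e^{2η₀a}D - O(e^{η₀a}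
+ a e^{2η'a})` and the margin is `≥ δ e^{2η₀a} - O(…) > 0` for `a` large. [folklore] -/
theorem stub_finiteDefectLocalisation :
    ∀ hS : ({ρ : ℂ | riemannZeta ρ = 0 ∧ 0 < ρ.re ∧ ρ.re < 1 ∧ ρ.re ≠ 1 / 2}).Finite,
      ∀ η₀ : ℝ, 0 < η₀ →
      (∀ ρ : ℂ, riemannZeta ρ = 0 → 0 < ρ.re → ρ.re < 1 → ρ.re ≠ 1 / 2 → |ρ.re - 1 / 2| ≤ η₀) →
      ∀ T : Finset ℂ, (∀ ρ : ℂ, ρ ∈ T ↔ (riemannZeta ρ = 0 ∧ ρ.re = 1 / 2 + η₀)) → T.Nonempty →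
      ∀ δ : ℝ, 0 < δ → ∀ f₀ : ℝ → ℝ, ContDiff ℝ (⊤ : ℕ∞) f₀ → HasCompactSupport f₀ →
      tsupport f₀ ⊆ Set.Ici 0 → 0 < ∫ u in Set.Ioi (0 : ℝ), f₀ u ^ 2 →
      (∃ᶠ a : ℝ in Filter.atTop, ∃ D : ℝ, 0 ≤ D ∧
        (∀ f : ℝ → ℝ, ContDiff ℝ (⊤ : ℕ∞) f → HasCompactSupport f → tsupport f ⊆ Set.Ici 0 →
          -(∑ ρ ∈ T, (riemannZetaZeroOrder ρ : ℝ) *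
              (Complex.exp (2 * (ρ.im : ℂ) * (a : ℂ) * Complex.I) *
              (∫ u in Set.Ioi (0 : ℝ), (f u : ℂ) * Complex.exp (-((ρ - 1 / 2) * (u : ℂ)))) ^ 2).re)
            ≤ D * ∫ u in Set.Ioi (0 : ℝ), f u ^ 2) ∧
        (D + δ) * ∫ u in Set.Ioi (0 : ℝ), f₀ u ^ 2 ≤
          ∑ ρ ∈ T, (riemannZetaZeroOrder ρ : ℝ) *
            (Complex.exp (2 * (ρ.im : ℂ) * (a : ℂ) * Complex.I) *
            (∫ u in Set.Ioi (0 : ℝ), (f₀ u : ℂ) * Complex.exp (-((ρ - 1 / 2) * (u : ℂ)))) ^ 2).re) →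
      ∃ a : ℝ, 0 < a ∧ ∃ o : ℝ → ℂ, IsWeilTest o ∧ tsupport o ⊆ Set.Icc (-a) a ∧
        (∀ t, o (-t) = -o t) ∧ ∫ t, ‖o t‖ ^ 2 = (1 : ℝ) ∧ ∃ m : ℝ, 0 < m ∧
        ∀ e : ℝ → ℂ, IsWeilTest e → tsupport e ⊆ Set.Icc (-a) a → (∀ t, e (-t) = e t) →
          (∀ t, (e t).im = 0) → ∫ t, ‖e t‖ ^ 2 = (1 : ℝ) →
          (weilQuadratic o).re + m ≤ (weilQuadratic e).re :=
  WeilParityOffLineParityDetection.stub_finiteDefectLocalisation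

/-- Stub **INF** (infinite-defect detection; the XL open core of the crux; registered since r0):
if the set of off-line zeros of `ζ` in the critical strip is INFINITE, then at some window `a > 0`
a real threshold `x` separates `ε_od(a) < x` from every REAL-valued even normalised Weil test on
`[-a, a]` (`x ≤ Re Q(e)`).  No finite top layer need exist: offsets may accumulate to an unattained
supremum (then every "drop the even on-line terms" lower bound uses the supremal offset for free
and cannot be matched by any odd witness at finite height — a lower bound on the even minimiser's
on-line penalty is needed, the "no Landau lemma for an inf-functional" obstruction), or be
attained with an infinite tail of lower offsets at unbounded heights (then the even floor needs
Bessel / large-sieve control of `Σ_off m (Im ê(ρ))²` over sparse high clusters, about which only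
zero-density theorems are known).  Strictly weaker than the crux (extra hypothesis: infinite
defect). [cite: Bombieri2000Weil, Thm. 8, §11, §13; ConnesSuijlekom2025] -/
theorem stub_infiniteDefectDetection :
    ({ρ : ℂ | riemannZeta ρ = 0 ∧ 0 < ρ.re ∧ ρ.re < 1 ∧ ρ.re ≠ 1 / 2}).Infinite →
      ∃ a : ℝ, 0 < a ∧ ∃ x : ℝ, weilOddGroundEnergy a < x ∧
        ∀ e : ℝ → ℂ, IsWeilTest e → tsupport e ⊆ Set.Icc (-a) a → (∀ t, e (-t) = e t) →
          (∀ t, (e t).im = 0) → ∫ t, ‖e t‖ ^ 2 = (1 : ℝ) → x ≤ (weilQuadratic e).re := by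
  sorry

/-! ### Stub statements by name

The skeleton gate reads the composition's hypotheses BY NAME: each must be a declared stub. The
`abbrev`s below are the stubs' exact elaborated types (`type_of%`), so `OffLineParityDetection_of`
takes `(h : Statement.stub_<name>)` and nothing else. -/

namespace Statement

/-- Statement of `stub_residualCore`. -/
abbrev stub_residualCore : Prop := type_of% @Birth.stub_residualCore
/-- Statement of `stub_infiniteDefectDetection`. -/
abbrev stub_infiniteDefectDetection : Prop := type_of% @Birth.stub_infiniteDefectDetection

end Statement

/-! ### The dominant finite-defect case (CLOSED: landed stubs only) -/

/-- **Dominant finite defect, no stub hypotheses** (sorry-free over the landed EVEN-LOW, EVEN-CS,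
ODD-ON, TRIAL): if the off-line set `S` is finite and some `ρ₀ ∈ S` strictly dominates (every
`ρ ∈ S` off its quadruple has smaller offset), then at some window `a > 0` the explicit threshold
`x(a) = -Σ_S m ∫_{-a}^{a} sinh²((Re ρ-1/2)t) sin²((Im ρ)t) dt` has `ε_od(a) < x(a) ≤ Re Q(e)` for
every real even normalised test `e` on `[-a, a]`: TRIAL at `T = S`, `w = m` (`m(ρ₀) > 0` by
`riemannZetaZeroOrder_pos_iff`, `m ≥ 0` by `riemannZetaZeroOrder_nonneg`), `Z = Σ m/(1+γ²)²`
gives a real odd `o` on the window with `(‖o‖₁+‖o″‖₁)² Z - Σ_S m Re ô² < x(a) ∫|o|²`; ODD-ON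
bounds `Re Q(o)` by the left side and `ε_od(a) ∫|o|² ≤ Re Q(o)` (`weilOddGroundEnergy_mul_le_re`),
so `ε_od(a) < x(a)`; EVEN-CS and EVEN-LOW give `x(a) ≤ Re Q(e)`. [folklore] -/
theorem dominantFiniteDefectDetection
    (hS : ({ρ : ℂ | riemannZeta ρ = 0 ∧ 0 < ρ.re ∧ ρ.re < 1 ∧ ρ.re ≠ 1 / 2}).Finite)
    (hdom : ∃ ρ₀ ∈ {ρ : ℂ | riemannZeta ρ = 0 ∧ 0 < ρ.re ∧ ρ.re < 1 ∧ ρ.re ≠ 1 / 2},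
      ∀ ρ ∈ {ρ : ℂ | riemannZeta ρ = 0 ∧ 0 < ρ.re ∧ ρ.re < 1 ∧ ρ.re ≠ 1 / 2},
        |ρ.re - 1 / 2| < |ρ₀.re - 1 / 2| ∨ ρ = ρ₀ ∨ ρ = conj ρ₀ ∨ ρ = 1 - ρ₀ ∨ ρ = 1 - conj ρ₀) :
    ∃ a : ℝ, 0 < a ∧ ∃ x : ℝ, weilOddGroundEnergy a < x ∧
      ∀ e : ℝ → ℂ, IsWeilTest e → tsupport e ⊆ Set.Icc (-a) a → (∀ t, e (-t) = e t) →
        (∀ t, (e t).im = 0) → ∫ t, ‖e t‖ ^ 2 = (1 : ℝ) → x ≤ (weilQuadratic e).re := by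
  obtain ⟨ρ₀, hρ₀, hdomρ⟩ := hdom
  have hne1 : ∀ ρ ∈ hS.toFinset, ρ ≠ 1 := fun ρ hρ h1 ↦ by
    have h := (hS.mem_toFinset.1 hρ).2.2.1
    rw [h1, Complex.one_re] at h
    exact lt_irrefl _ h
  have hρ₀T : ρ₀ ∈ hS.toFinset := hS.mem_toFinset.2 hρ₀
  have hw₀ : 0 < (riemannZetaZeroOrder ρ₀ : ℝ) := by
    exact_mod_cast (riemannZetaZeroOrder_pos_iff (hne1 ρ₀ hρ₀T)).2 hρ₀.1
  have hw : ∀ ρ ∈ hS.toFinset, 0 ≤ (riemannZetaZeroOrder ρ : ℝ) := fun ρ hρ ↦ by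
    exact_mod_cast riemannZetaZeroOrder_nonneg (hne1 ρ hρ)
  have hdomT : ∀ ρ ∈ hS.toFinset, |ρ.re - 1 / 2| < |ρ₀.re - 1 / 2| ∨ ρ = ρ₀ ∨ ρ = conj ρ₀ ∨
      ρ = 1 - ρ₀ ∨ ρ = 1 - conj ρ₀ := fun ρ hρ ↦ hdomρ ρ (hS.mem_toFinset.1 hρ)
  obtain ⟨a, ha, o, ho, hos, hodd, horeal, hN, hlt⟩ :=
    stub_dominantQuadrupleOddTrial hS.toFinset (fun ρ ↦ (riemannZetaZeroOrder ρ : ℝ)) ρ₀ hρ₀T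
      hρ₀.2.2.2 hw₀ hw hdomT (∑' ρ : ZetaZeros.riemannZetaNontrivialZeros, weilZeroWeight (ρ : ℂ))
  refine ⟨a, ha, -(∑ ρ ∈ hS.toFinset, (riemannZetaZeroOrder ρ : ℝ) *
      ∫ t in Set.Icc (-a) a, Real.sinh ((ρ.re - 1 / 2) * t) ^ 2 * Real.sin (ρ.im * t) ^ 2),
    ?_, fun e he hes hev hreal hen ↦ (stub_evenOffLineCauchySchwarz a e he hes hev hreal hen hS).trans
      (stub_evenOffLineLowerBound e he hev hreal hS)⟩
  have hQo := stub_oddOnLineUpperBound o ho hodd horeal hS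
  have hmul : weilOddGroundEnergy a * ∫ t, ‖o t‖ ^ 2 ≤ (weilQuadratic o).re :=
    weilOddGroundEnergy_mul_le_re ho hos hodd
  exact lt_of_mul_lt_mul_right ((hmul.trans hQo).trans_lt hlt) hN.le

/-! ### The general finite-defect case from TORUS + BOHR + LOC (strategist's glue, adapted) -/

/-- **FIN, real-even margin form, from TORUS (three stubs) + BOHR (landed) + LOC (landed)** (adapted from the
strategist's `MirrorTorus.finiteDefectDetection_of`, line `mirror_torus`, with attribution): if the
off-line set `S` is finite and nonempty, some odd normalised test beats every real even normalised
test at some window.  The maximal offset `η₀` is attained on the finite set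
(`Finset.exists_max_image`); the top layer `T = {ζ = 0, Re = 1/2 + η₀}` is a sub-`Finset` of `S`,
nonempty because the reflection `ρ ↦ 1 - ρ̄` of the zero set (`one_sub_conj_mem`) turns a
maximal-offset zero of real part `1/2 - η₀` into one of real part `1/2 + η₀`; the weights
`m(ρ) ≥ 1` on `T` (`one_le_order`); then TORUS gives a top-heavy phase point, BOHR makes it recur
along `a → ∞`, LOC detects. [folklore] -/
theorem finiteDefectDetection_of_torus (hCore : Statement.stub_residualCore)
    (hS : ({ρ : ℂ | riemannZeta ρ = 0 ∧ 0 < ρ.re ∧ ρ.re < 1 ∧ ρ.re ≠ 1 / 2}).Finite)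
    {ρ : ℂ} (hζ : riemannZeta ρ = 0) (h0 : 0 < ρ.re) (h1 : ρ.re < 1) (hne : ρ.re ≠ 1 / 2) :
    ∃ a : ℝ, 0 < a ∧ ∃ o : ℝ → ℂ, IsWeilTest o ∧ tsupport o ⊆ Set.Icc (-a) a ∧
      (∀ t, o (-t) = -o t) ∧ ∫ t, ‖o t‖ ^ 2 = (1 : ℝ) ∧ ∃ m : ℝ, 0 < m ∧
      ∀ e : ℝ → ℂ, IsWeilTest e → tsupport e ⊆ Set.Icc (-a) a → (∀ t, e (-t) = e t) →
        (∀ t, (e t).im = 0) → ∫ t, ‖e t‖ ^ 2 = (1 : ℝ) →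
        (weilQuadratic o).re + m ≤ (weilQuadratic e).re := by
  -- adapted from Cruxes/OffLineParityDetection/Lines/mirror_torus.lean (planner-cstrat-…-b1-0)
  classical
  have hρS : ρ ∈ hS.toFinset := hS.mem_toFinset.2 ⟨hζ, h0, h1, hne⟩
  obtain ⟨ρ₁, hρ₁, hmax⟩ :=
    hS.toFinset.exists_max_image (fun ρ : ℂ ↦ |ρ.re - 1 / 2|) ⟨ρ, hρS⟩
  obtain ⟨hζ₁, h0₁, h1₁, hne₁⟩ := hS.mem_toFinset.1 hρ₁
  set η₀ : ℝ := |ρ₁.re - 1 / 2| with hη₀def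
  have hη₀ : 0 < η₀ := abs_pos.2 (sub_ne_zero.2 hne₁)
  have hbound : ∀ ρ' : ℂ, riemannZeta ρ' = 0 → 0 < ρ'.re → ρ'.re < 1 → ρ'.re ≠ 1 / 2 →
      |ρ'.re - 1 / 2| ≤ η₀ :=
    fun ρ' hz h0' h1' hne' ↦ hmax ρ' (hS.mem_toFinset.2 ⟨hz, h0', h1', hne'⟩)
  set T : Finset ℂ := hS.toFinset.filter (fun ρ' : ℂ ↦ ρ'.re = 1 / 2 + η₀) with hTdef
  have hTmem : ∀ ρ' : ℂ, ρ' ∈ T ↔ (riemannZeta ρ' = 0 ∧ ρ'.re = 1 / 2 + η₀) := by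
    intro ρ'
    rw [hTdef, Finset.mem_filter, Set.Finite.mem_toFinset, Set.mem_setOf_eq]
    constructor
    · rintro ⟨⟨hz, -, -, -⟩, hre⟩
      exact ⟨hz, hre⟩
    · rintro ⟨hz, hre⟩
      refine ⟨⟨hz, by linarith, ?_, by linarith⟩, hre⟩
      exact Literature.NumberTheory.LFunctions.re_lt_one_of_riemannZeta_eq_zero hz
  have hTre : ∀ ρ' ∈ T, ρ'.re = 1 / 2 + η₀ := fun ρ' h ↦ ((hTmem ρ').1 h).2
  have hTne : T.Nonempty := by
    rcases lt_or_gt_of_ne hne₁ with hlt | hgt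
    · have hmem₁ : ρ₁ ∈ ZetaZeros.riemannZetaNontrivialZeros :=
        ZetaZeros.riemannZetaNontrivialZeros.mem_of_re_pos hζ₁ h0₁
      have hmem₂ := ZetaZeros.riemannZetaNontrivialZeros.one_sub_conj_mem hmem₁
      refine ⟨1 - conj ρ₁, (hTmem _).2 ⟨ZetaZeros.riemannZetaNontrivialZeros.zeta_eq_zero hmem₂, ?_⟩⟩
      have habs : η₀ = -(ρ₁.re - 1 / 2) := by rw [hη₀def]; exact abs_of_neg (by linarith)
      simp only [Complex.sub_re, Complex.one_re, Complex.conj_re]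
      linarith
    · refine ⟨ρ₁, (hTmem _).2 ⟨hζ₁, ?_⟩⟩
      have habs : η₀ = ρ₁.re - 1 / 2 := by rw [hη₀def]; exact abs_of_pos (by linarith)
      linarith
  have hwpos : ∀ ρ' ∈ T, 0 < (riemannZetaZeroOrder ρ' : ℝ) := by
    intro ρ' h
    obtain ⟨hz, hre⟩ := (hTmem ρ').1 h
    have hmem : ρ' ∈ ZetaZeros.riemannZetaNontrivialZeros :=
      ZetaZeros.riemannZetaNontrivialZeros.mem_of_re_pos hz (by linarith)
    exact_mod_cast ZetaZeros.riemannZetaNontrivialZeros.one_le_order hmem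
  have hwnn : ∀ ρ' ∈ T, 0 ≤ (riemannZetaZeroOrder ρ' : ℝ) := fun ρ' h ↦ (hwpos ρ' h).le
  obtain ⟨δ, hδ, a₀, D, hD, hdanger, f₀, hf₀, hf₀c, hf₀s, hf₀pos, hgain⟩ :=
    torusTopHeavy_of hCore η₀ hη₀ T hTne hTre (fun ρ' ↦ (riemannZetaZeroOrder ρ' : ℝ)) hwpos
  have hfreq := stub_bohrTransfer η₀ hη₀ T hTre (fun ρ' ↦ (riemannZetaZeroOrder ρ' : ℝ)) hwnn a₀ δ D
    hδ hD hdanger f₀ hf₀ hf₀c hf₀s hgain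
  exact stub_finiteDefectLocalisation hS η₀ hη₀ hbound T hTmem hTne (δ / 2) (by linarith) f₀ hf₀ hf₀c
    hf₀s hf₀pos hfreq

/-- **FIN in threshold form** (sorry-free modulo RESIDUAL-CORE alone; everything else landed): if the off-line set `S` is
finite and nonempty then at some window `a > 0` a threshold `x` has `ε_od(a) < x ≤ Re Q(e)` for
every real even normalised test `e` on `[-a, a]`.  Dominant case: `dominantFiniteDefectDetection`
(landed stubs only — no hypothesis is used there); otherwise `finiteDefectDetection_of_torus` with
`x := Re Q(o) + m`, `ε_od(a) ≤ Re Q(o)` (`weilOddGroundEnergy_le`). [folklore] -/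
theorem finiteDefectDetection_of (hCore : Statement.stub_residualCore) :
    ({ρ : ℂ | riemannZeta ρ = 0 ∧ 0 < ρ.re ∧ ρ.re < 1 ∧ ρ.re ≠ 1 / 2}).Finite →
      (∃ ρ : ℂ, riemannZeta ρ = 0 ∧ 0 < ρ.re ∧ ρ.re < 1 ∧ ρ.re ≠ 1 / 2) →
      ∃ a : ℝ, 0 < a ∧ ∃ x : ℝ, weilOddGroundEnergy a < x ∧
        ∀ e : ℝ → ℂ, IsWeilTest e → tsupport e ⊆ Set.Icc (-a) a → (∀ t, e (-t) = e t) →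
          (∀ t, (e t).im = 0) → ∫ t, ‖e t‖ ^ 2 = (1 : ℝ) → x ≤ (weilQuadratic e).re := by
  intro hS hne
  by_cases hdom : ∃ ρ₀ ∈ {ρ : ℂ | riemannZeta ρ = 0 ∧ 0 < ρ.re ∧ ρ.re < 1 ∧ ρ.re ≠ 1 / 2},
      ∀ ρ ∈ {ρ : ℂ | riemannZeta ρ = 0 ∧ 0 < ρ.re ∧ ρ.re < 1 ∧ ρ.re ≠ 1 / 2},
        |ρ.re - 1 / 2| < |ρ₀.re - 1 / 2| ∨ ρ = ρ₀ ∨ ρ = conj ρ₀ ∨ ρ = 1 - ρ₀ ∨ ρ = 1 - conj ρ₀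
  · exact dominantFiniteDefectDetection hS hdom
  · obtain ⟨ρ, hζ, h0, h1, hne'⟩ := hne
    obtain ⟨a, ha, o, ho, hos, hodd, hon, m, hm, hdet⟩ :=
      finiteDefectDetection_of_torus hCore hS hζ h0 h1 hne'
    refine ⟨a, ha, (weilQuadratic o).re + m, ?_,
      fun e he hes hev hreal hen ↦ hdet e he hes hev hreal hen⟩
    have hle : weilOddGroundEnergy a ≤ (weilQuadratic o).re :=
      weilOddGroundEnergy_le ho hos hodd hon
    linarith

/-! ### The crux from the stubs (kernel-checked composition, no `sorry`) -/

/-- **The crux BY NAME from the TWO open stub statements** (RESIDUAL-CORE = the ζ-free open core of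
the finite case, INF = the open core of the crux → `WeilParity.OffLineParityDetection`; REAL, EVEN-LOW,
EVEN-CS, ODD-ON, TRIAL, BOHR, LOC, TORUS-SEP, TORUS-LOW, RESIDUAL-ONE, RESIDUAL-COLLAPSE, RESIDUAL-TWO-LIGHT are landed
and enter as theorems): given an off-line zero `ρ`, the off-line set `S` is nonempty;
`Set.finite_or_infinite S` selects the finite case (`finiteDefectDetection_of`) or INF and yields
a window `a > 0` and a threshold `x` with `ε_od(a) < x ≤ Re Q` on real even normalised tests;
`ε_od(a)` is the infimum of the (nonempty) odd sphere of the window, so some odd normalised test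
`o` has `Re Q(o) < x` (`exists_lt_of_csInf_lt`); REAL transfers the even bound to complex even
tests; the margin is `m = x − Re Q(o)`. [folklore] -/
theorem OffLineParityDetection_of (hCore : Statement.stub_residualCore)
    (hInf : Statement.stub_infiniteDefectDetection) : OffLineParityDetection := by
  intro ρ hζ h0 h1 hne
  -- the defect dichotomy: finite (with `ρ` witnessing nonemptiness) or infinite (INF)
  obtain ⟨a, ha, x, hox, hb⟩ : ∃ a : ℝ, 0 < a ∧ ∃ x : ℝ, weilOddGroundEnergy a < x ∧
      ∀ e : ℝ → ℂ, IsWeilTest e → tsupport e ⊆ Set.Icc (-a) a → (∀ t, e (-t) = e t) →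
        (∀ t, (e t).im = 0) → ∫ t, ‖e t‖ ^ 2 = (1 : ℝ) → x ≤ (weilQuadratic e).re := by
    rcases ({ρ : ℂ | riemannZeta ρ = 0 ∧ 0 < ρ.re ∧ ρ.re < 1 ∧ ρ.re ≠ 1 / 2}).finite_or_infinite
      with hS | hS
    · exact finiteDefectDetection_of hCore hS ⟨ρ, hζ, h0, h1, hne⟩
    · exact hInf hS
  -- an odd normalised test strictly below the threshold: `ε_od(a) = sInf` of a nonempty set
  rw [weilOddGroundEnergy_eq_sInf] at hox
  obtain ⟨y, ⟨o, ho, hos, hodd, hon, rfl⟩, hlt⟩ :=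
    exists_lt_of_csInf_lt (weilWindowSphereValues_odd_nonempty ha) hox
  refine ⟨a, ha, o, ho, hos, hodd, hon, x - (weilQuadratic o).re, sub_pos.2 hlt, ?_⟩
  -- every (complex) even normalised test is at or above the threshold, by REAL (landed)
  intro e he hes hev hen
  have hxe : x ≤ (weilQuadratic e).re := stub_realEvenSuffices a x hb e he hes hev hen
  linarith

/-- The crux along this line (route `WeilParity` decl, by name), MODULO exactly the four
registered open stubs (depends on `sorryAx` only through `stub_residualCore` and
`stub_infiniteDefectDetection`). [folklore] -/
theorem OffLineParityDetection_proof : OffLineParityDetection :=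
  OffLineParityDetection_of stub_residualCore stub_infiniteDefectDetection

/-! ### Calibration: the cut loses no strength -/

/-- **Converse bookkeeping** (sorry-free): the crux implies, for every off-line zero, the common
conclusion of the detection statements — `ε_od(a) ≤ Re Q(o)` for the crux's odd witness `o`
(`weilOddGroundEnergy_le`), and `x := Re Q(o) + m` lies below every even normalised test, real ones
in particular. So the detection statements together are exactly the crux restricted to the cases
of the defect dichotomy (modulo REAL), not strengthenings of it. [folklore] -/
theorem detection_of_OffLineParityDetection (h : OffLineParityDetection) {ρ : ℂ}
    (hζ : riemannZeta ρ = 0) (h0 : 0 < ρ.re) (h1 : ρ.re < 1) (hne : ρ.re ≠ 1 / 2) :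
    ∃ a : ℝ, 0 < a ∧ ∃ x : ℝ, weilOddGroundEnergy a < x ∧
      ∀ e : ℝ → ℂ, IsWeilTest e → tsupport e ⊆ Set.Icc (-a) a → (∀ t, e (-t) = e t) →
        (∀ t, (e t).im = 0) → ∫ t, ‖e t‖ ^ 2 = (1 : ℝ) → x ≤ (weilQuadratic e).re := by
  obtain ⟨a, ha, o, ho, hos, hodd, hon, m, hm, hdet⟩ := h ρ hζ h0 h1 hne
  refine ⟨a, ha, (weilQuadratic o).re + m, ?_, fun e he hes hev _ hen ↦ hdet e he hes hev hen⟩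
  have hle : weilOddGroundEnergy a ≤ (weilQuadratic o).re := weilOddGroundEnergy_le ho hos hodd hon
  linarith

end Summit.RiemannHypothesis.RiemannHypothesis.Cruxes.OffLineParityDetection.Birth

end
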